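import Summits.NavierStokesRegularity.NavierStokesRegularity.Theorems.SwirlFreeBudget
import Summits.NavierStokesRegularity.NavierStokesRegularity.Theorems.SwirlFreeBudgetLocalDictionary
import Summits.NavierStokesRegularity.NavierStokesRegularity.Theorems.SwirlFreeBudgetVelocityFromCurl
import Literature.Analysis.FluidPDE.SereginZajaczkowski2007L42
import Literature.Analysis.FluidPDE.AxisymNoSwirlLocalMaxPrinciple
import HarnessLib

/-!
# SwirlFreeBudget, crux K-18.2 (T-18.5), SMOOTH-CASE CORE: `EtaMoserBound` bounds the velocity of a
# smooth swirl-free axisymmetric solution by the gauges `A`, `E` (seat nsreg-p4)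

Support file for the DORMANT route `SwirlThreshold` (crux stmt-NavierStokesRegularity-2002) and
planner nsreg-p2's ROUND-18 assembly `EtaMoserBound → SwirlFreePolynomialBound`
(`…Theorems.SwirlFreeBudget`).  The analytic core of K-18.2, for the SMOOTH class and with the
swirl-free axisymmetric structure holding EVERYWHERE (the poloidal representative): assuming
`EtaMoserBound` (K-18.1), on an axis-centred cylinder `Q(z₀, R)` with `A(z₀,R) ≤ A`, `E(z₀,R) ≤ E`,

  `‖V(t,x)‖ ≤ K(1+A)^K √E /(8R) + 512·C·(π/6 + A/R²)`  on `Q(z₀, R/8)`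

(`velocity_bound_of_etaMoserBound`; `K` from `EtaMoserBound`, `C` the Helmholtz constant).  Chain:
`EtaMoserBound` (`|ω_θ/r| ≤ Λ_η = K(1+A)^K√E/R³` on `Q(R/2)`) ⇒ local dictionary
(`norm_curl_le_of_abs_angVortQuot_le`: `‖curl V‖ ≤ Λ_η R/2` on the axis-centred ball `B(R/2)`)
⇒ energy-form Helmholtz bound (`exists_const_norm_le_of_curl_le_energy` at radius `R/2`, with
`∫_{B(R)} ‖V(t)‖² ≤ R·A` from `cknA` and `div V = 0` from the smooth class).
What remains for `SwirlFreePolynomialBound` is the reduction suitable-weak → smooth below the first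
singular time (tree: `…EulerScaling.clean_point_backwardRegular`, poloidal representative) and the
bound on `E` from the full gauge (`Seregin2020.localEnergyBound_top` / CTZ22 Lemma 3.1).

WHAT THIS IS NOT: not NS regularity — a conditional (on the open K-18.1 `EtaMoserBound`) a-priori
estimate for smooth solutions; `SwirlFreePolynomialBound` and all hard cores untouched; no crux claim.
-/

namespace Summit.NavierStokesRegularity.NavierStokesRegularity.Theorems.SwirlFreeBudget

open Set Filter Topology Metric MeasureTheory
open scoped ENNReal
open Literature.Analysis Literature.Analysis.FluidPDE
open Literature.Analysis.FluidPDE.SereginZajaczkowski2007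

noncomputable section

/-- From the scaled energy gauge: for `t` in the time window of `Q(z₀,R)`,
`∫_{B(x₀,R)} ‖V t‖² ≤ R·A` and `‖V t‖²` is integrable there (given measurability). -/
theorem integral_norm_sq_le_of_cknA {V : ℝ → EuclideanSpace ℝ (Fin 3) → EuclideanSpace ℝ (Fin 3)}
    {z₀ : ℝ × EuclideanSpace ℝ (Fin 3)} {R A : ℝ} (hR : 0 < R) (hA : 0 ≤ A)
    (hcknA : cknA R z₀ V ≤ ENNReal.ofReal A) {t : ℝ} (ht : t ∈ Ioo (z₀.1 - R ^ 2) z₀.1)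
    (hmeas : AEStronglyMeasurable (V t) (volume.restrict (ball z₀.2 R))) :
    IntegrableOn (fun y => ‖V t y‖ ^ 2) (ball z₀.2 R) ∧ ∫ y in ball z₀.2 R, ‖V t y‖ ^ 2 ≤ R * A := by
  -- the slice bound in `ℝ≥0∞`
  have hslice : (ENNReal.ofReal R)⁻¹ * ∫⁻ y in ball z₀.2 R, ‖V t y‖ₑ ^ 2 ≤ ENNReal.ofReal A := by
    refine le_trans ?_ hcknA
    unfold cknA
    exact le_iSup₂ (f := fun s (_ : s ∈ Ioo (z₀.1 - R ^ 2) z₀.1) =>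
      (ENNReal.ofReal R)⁻¹ * ∫⁻ y in ball z₀.2 R, ‖V s y‖ₑ ^ 2) t ht
  have hR0 : ENNReal.ofReal R ≠ 0 := by rw [ne_eq, ENNReal.ofReal_eq_zero, not_le]; exact hR
  have hlin : ∫⁻ y in ball z₀.2 R, ‖V t y‖ₑ ^ 2 ≤ ENNReal.ofReal R * ENNReal.ofReal A := by
    calc ∫⁻ y in ball z₀.2 R, ‖V t y‖ₑ ^ 2
        = ENNReal.ofReal R * ((ENNReal.ofReal R)⁻¹ * ∫⁻ y in ball z₀.2 R, ‖V t y‖ₑ ^ 2) := by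
          rw [← mul_assoc, ENNReal.mul_inv_cancel hR0 ENNReal.ofReal_ne_top, one_mul]
      _ ≤ ENNReal.ofReal R * ENNReal.ofReal A := by gcongr
  have hlt : ∫⁻ y in ball z₀.2 R, ‖V t y‖ₑ ^ 2 < ⊤ :=
    lt_of_le_of_lt hlin (ENNReal.mul_lt_top ENNReal.ofReal_lt_top ENNReal.ofReal_lt_top)
  -- the pointwise identity `‖ ‖v‖² ‖ₑ = ‖v‖ₑ²`
  have henorm : ∀ y, ‖‖V t y‖ ^ 2‖ₑ = ‖V t y‖ₑ ^ 2 := fun y => by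
    rw [Real.enorm_eq_ofReal (sq_nonneg _), ENNReal.ofReal_pow (norm_nonneg _), ofReal_norm]
  have hint : IntegrableOn (fun y => ‖V t y‖ ^ 2) (ball z₀.2 R) := by
    refine ⟨hmeas.norm.pow 2, ?_⟩
    rw [hasFiniteIntegral_iff_enorm]
    simp_rw [henorm]
    exact hlt
  refine ⟨hint, ?_⟩
  rw [integral_eq_lintegral_of_nonneg_ae (Eventually.of_forall fun y => sq_nonneg _)
    hint.aestronglyMeasurable]
  have heq : ∫⁻ y in ball z₀.2 R, ENNReal.ofReal (‖V t y‖ ^ 2) = ∫⁻ y in ball z₀.2 R, ‖V t y‖ₑ ^ 2 :=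
    lintegral_congr fun y => by rw [ENNReal.ofReal_pow (norm_nonneg _), ofReal_norm]
  rw [heq]
  calc (∫⁻ y in ball z₀.2 R, ‖V t y‖ₑ ^ 2).toReal ≤ (ENNReal.ofReal R * ENNReal.ofReal A).toReal :=
        ENNReal.toReal_mono (ENNReal.mul_ne_top ENNReal.ofReal_ne_top ENNReal.ofReal_ne_top) hlin
    _ = R * A := by rw [ENNReal.toReal_mul, ENNReal.toReal_ofReal hR.le, ENNReal.toReal_ofReal hA]

/-- **K-18.2, SMOOTH-CASE CORE.**  Assume `EtaMoserBound` (K-18.1).  There are `K > 0` (from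
`EtaMoserBound`) and an absolute `C ≥ 0` such that for every smooth axisymmetric swirl-free
solution `(V, P)` on an axis-centred cylinder `Q(z₀, R)` whose slices are axisymmetric and swirl
free everywhere, with `A(z₀,R) ≤ A` and `E(z₀,R) ≤ E`:
`‖V(t, x)‖ ≤ K(1+A)^K √E/(8R) + 512 C ((4/3)π/8 + A/R²)` for all `(t, x) ∈ Q(z₀, R/8)`. -/
theorem velocity_bound_of_etaMoserBound (hEta : EtaMoserBound) :
    ∃ K C : ℝ, 0 < K ∧ 0 ≤ C ∧
      ∀ (V : ℝ → EuclideanSpace ℝ (Fin 3) → EuclideanSpace ℝ (Fin 3))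
        (P : ℝ → EuclideanSpace ℝ (Fin 3) → ℝ) (z₀ : ℝ × EuclideanSpace ℝ (Fin 3)) (R : ℝ),
        0 < R → cylRadius z₀.2 = 0 →
        IsSmoothAxisymmetricSolutionOn (parabolicCylinderOpens R z₀) V P →
        (∀ t, IsAxisymmetric (V t)) → (∀ t, HasNoSwirl (V t)) →
        ∀ A E : ℝ, 0 ≤ A → 0 ≤ E →
        cknA R z₀ V ≤ ENNReal.ofReal A →
        cknE R z₀ (fun t x => fderiv ℝ (V t) x) ≤ ENNReal.ofReal E →
        ∀ z ∈ parabolicCylinder (R / 8) z₀,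
          ‖V z.1 z.2‖ ≤ K * (1 + A) ^ K * Real.sqrt E / (8 * R) +
            512 * C * ((volume (ball z₀.2 (R / 2))).toReal / R ^ 3 + A / R ^ 2) := by
  obtain ⟨K, hK, hEta⟩ := hEta
  obtain ⟨C, hC0, hC⟩ := exists_const_norm_le_of_curl_le_energy
  refine ⟨K, C, hK, hC0, ?_⟩
  intro V P z₀ R hR haxis hsm hax hsw A E hA hE hcknA hcknE z hz
  have hswQ : ∀ w ∈ parabolicCylinder R z₀, swirl (V w.1) w.2 = 0 := fun w _ => hsw w.1 w.2
  have hη := hEta V P z₀ R hR haxis hsm hswQ A E hA hE hcknA hcknE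
  -- the point and its time slice
  rw [mem_parabolicCylinder] at hz
  obtain ⟨⟨ht1, ht2⟩, hxd⟩ := hz
  have hR8 : (R / 8) ^ 2 ≤ R ^ 2 := by nlinarith
  have hR2 : (R / 8) ^ 2 ≤ (R / 2) ^ 2 := by nlinarith
  have htR : z.1 ∈ Ioo (z₀.1 - R ^ 2) z₀.1 := ⟨by linarith, ht2⟩
  set c := z₀.2 with hc
  set W : EuclideanSpace ℝ (Fin 3) → EuclideanSpace ℝ (Fin 3) := V z.1 with hW
  -- slice points of `ball c R` at time `z.1` lie in `Q(z₀, R)`; of `ball c (R/2)` in `Q(z₀, R/2)`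
  have hmemR : ∀ y ∈ ball c R, ((z.1, y) : ℝ × EuclideanSpace ℝ (Fin 3)) ∈
      ((parabolicCylinderOpens R z₀ : TopologicalSpace.Opens (ℝ × EuclideanSpace ℝ (Fin 3))) :
        Set (ℝ × EuclideanSpace ℝ (Fin 3))) := by
    intro y hy
    rw [coe_parabolicCylinderOpens, mem_parabolicCylinder]
    exact ⟨⟨by linarith, ht2⟩, mem_ball.1 hy⟩
  have hmemR2 : ∀ y ∈ ball c (R / 2), ((z.1, y) : ℝ × EuclideanSpace ℝ (Fin 3)) ∈
      parabolicCylinder (R / 2) z₀ := by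
    intro y hy
    rw [mem_parabolicCylinder]
    exact ⟨⟨by linarith, ht2⟩, mem_ball.1 hy⟩
  -- smoothness, divergence, η-bound on the slice
  have hW3 : ContDiffOn ℝ 3 W (ball c R) := fun y hy =>
    ((hsm.contDiffAt (z.1, y) (hmemR y hy)).of_le (by norm_cast)).contDiffWithinAt
  have hW2 : ∀ y ∈ ball c (R / 2), ContDiffAt ℝ 2 W y := fun y hy =>
    (hsm.contDiffAt (z.1, y) (hmemR y (ball_subset_ball (by linarith) hy))).of_le (by norm_cast)
  have hdiv : ∀ y ∈ ball c (R / 2), VectorCalculus.divergence W y = 0 := fun y hy =>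
    hsm.divergence_eq_zero (hmemR y (ball_subset_ball (by linarith) hy))
  have hΛ : 0 ≤ K * (1 + A) ^ K * Real.sqrt E / R ^ 3 := by positivity
  have hηball : ∀ y ∈ ball c (R / 2), |angVortQuot W y| ≤ K * (1 + A) ^ K * Real.sqrt E / R ^ 3 :=
    fun y hy => hη (z.1, y) (hmemR2 y hy)
  -- the curl bound on `ball c (R/2)` from the local dictionary
  have hcurl : ∀ y ∈ ball c (R / 2), ‖curl W y‖ ≤ K * (1 + A) ^ K * Real.sqrt E / R ^ 3 * (R / 2) :=
    fun y hy => norm_curl_le_of_abs_angVortQuot_le haxis (hW3.mono (ball_subset_ball (by linarith)))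
      (hax z.1) (hsw z.1) hΛ hηball
      (fun w hw => (cylRadius_le_dist_of_axis ((cylRadius_eq_zero_iff c).1 haxis) w).trans
        (mem_ball.1 hw).le) hy
  -- energy on the slice
  have hmeas : AEStronglyMeasurable W (volume.restrict (ball c R)) :=
    hW3.continuousOn.aestronglyMeasurable measurableSet_ball
  obtain ⟨hintR, hER⟩ := integral_norm_sq_le_of_cknA hR hA hcknA htR hmeas
  have hint2 : IntegrableOn (fun y => ‖W y‖ ^ 2) (ball c (R / 2)) :=
    hintR.mono_set (ball_subset_ball (by linarith))
  have hE2 : ∫ y in ball c (R / 2), ‖W y‖ ^ 2 ≤ R * A :=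
    le_trans (setIntegral_mono_set hintR (Eventually.of_forall fun y => sq_nonneg _)
      (Eventually.of_forall (ball_subset_ball (by linarith)))) hER
  -- the Helmholtz bound at radius `R/2`, point `z.2 ∈ ball c (R/8) = ball c ((R/2)/4)`
  have hx : z.2 ∈ ball c (R / 2 / 4) := by rw [mem_ball, show R / 2 / 4 = R / 8 by ring]; exact hxd
  have hmain := hC W c (R / 2) (K * (1 + A) ^ K * Real.sqrt E / R ^ 3 * (R / 2)) (by positivity)
    hW2 hdiv hcurl hint2 z.2 hx
  have hvol : 0 ≤ (volume (ball c (R / 2))).toReal := ENNReal.toReal_nonneg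
  calc ‖V z.1 z.2‖ = ‖W z.2‖ := rfl
    _ ≤ K * (1 + A) ^ K * Real.sqrt E / R ^ 3 * (R / 2) * (R / 2) / 2 +
          64 * C * ((R / 2) ^ 3)⁻¹ * ((volume (ball c (R / 2))).toReal + ∫ y in ball c (R / 2), ‖W y‖ ^ 2) :=
        hmain
    _ ≤ K * (1 + A) ^ K * Real.sqrt E / R ^ 3 * (R / 2) * (R / 2) / 2 +
          64 * C * ((R / 2) ^ 3)⁻¹ * ((volume (ball c (R / 2))).toReal + R * A) := by
        gcongr
    _ = K * (1 + A) ^ K * Real.sqrt E / (8 * R) +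
          512 * C * ((volume (ball c (R / 2))).toReal / R ^ 3 + A / R ^ 2) := by
        field_simp
        ring

end

end Summit.NavierStokesRegularity.NavierStokesRegularity.Theorems.SwirlFreeBudget
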